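import Mathlib
import Summits.RiemannHypothesis.RiemannHypothesis.Theorems.HandoffDecomposition
import HarnessLib

/-!
# HANDOFF — THE ENTRANCE-POINT EXPANSION TO SECOND ORDER: the VALUE term (order δ) and the SLOPE term (order δ³) of the new prime's atom,
# term by term with opposite signs by parity (cell rh-explicit, TRACK «HANDOFF», seat theory-2 gen12; FILE XII-ε′; RH-free, elementary)

HONEST FRAMING. Nothing in this file bears on the truth of RH; it is real analysis on one function. XII-ε (`HandoffFlatEdge`) gave the
FIRST-order law: through the layer `[log q − b, b] = [m − δ, m + δ]` (`m = (log q)/2` the entrance point, `δ = b − m`) the atom of `q` acts,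
to first order in `δ`, as the rank-one form `−w_q δ·Re(g(m)·conj g(−m))`. The cell's DATA (theory-2 gen12 LAYER-FLATNESS, DERIVED-CHECK on
cc-s2-5's lifted K29/K37 ladders and cc-s2-3's K43/E29/E31 wall vectors): ODD vectors obey that law to 3.4 % at the wall (21/21), but the
EVEN wall vectors put a node near `m` (at `m + δ/4`), the value term is then small and of the wrong size (I/(2δv(m)²) = −4.5), and the
atom acts through the SECOND-order term — with two terms the layer integral is reproduced to 4 % (3/3). This file types the two-term
expansion with an explicit remainder, for the KINKED class (any `g` with `tsupport g ⊆ [−b, b]` and an integrable cross term; no smoothness):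
§1 the layer's moments about `m` (`∫(u − m) = 0`, `∫(u − m)² = 2δ³/3`) and the model integral
   `∫_{layer}(A + B(u − m) + C(u − m)²) du = 2δ·A + (2δ³/3)·C` (`integral_layer_model`) — the mixed first-order term drops out by symmetry;
§2 (`norm_layerIntegral_sub_twoTerm_le`) with first-order Taylor moduli `‖g(u) − g₀ − g₁(u − m)‖ ≤ (M₂/2)(u − m)²` on the layer and
   `‖g(v) − h₀ − h₁(v + m)‖ ≤ (M₂/2)(v + m)²` on the mirror layer:
   `‖∫_{layer} g(u)·conj g(u − log q) du − (2δ·g₀·conj h₀ + (2δ³/3)·g₁·conj h₁)‖ ≤ M₂δ³·(‖g₀‖ + ‖h₀‖ + (‖g₁‖ + ‖h₁‖)δ + M₂δ²/2)`;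
§3 the contribution as `−(2 log q/√q)·∫_{layer} Re(g(u)·conj g(u − log q)) du` (`contribution_eq_neg_mul_integral_re_layer`) and the PARITY
   LAWS: EVEN (`h₀ = g₀`, `h₁ = −g₁`): `contribution_q(g) = −(2 log q/√q)·(2δ‖g₀‖² − (2δ³/3)‖g₁‖²) + O(δ³·M₂)` — CHARGED the squared value,
   REWARDED the squared slope at the entrance point (`abs_contribution_add_twoTerm_le_of_even`); ODD (`h₀ = −g₀`, `h₁ = g₁`): the opposite
   signs (`abs_contribution_sub_twoTerm_le_of_odd`). One expansion about the entrance point carries both sectors: odd lives on the order-δ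
   value term (the wall: XII-ε, XII-t `contribution_odd_le_linear`), even on the order-δ³ slope term (the margin: XII-t
   `contribution_even_le_cubic`, XII-q's «node at the entrance point is rewarded») — here as two-sided identities with remainder.
What is NOT here (DATA/MODEL): the node position `δ/4`, the ratios 3.4 % / 4 %, the wall values, anything about eigenvalues or ζ. No `def`s.
References: A. Connes, C. Consani, Enseign. Math. 69 (2023) §2.2–2.3 [`ConnesConsani2023`]; E. Bombieri, Rend. Mat. Acc. Lincei (9) 11 (2000)
§2 [`Bombieri2000Weil`]; the expansion is this track's bookkeeping [folklore]. Companions: XII-ε `HandoffFlatEdge` (first order; not imported —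
its olean may lag the farm; the layer identity is re-derived here in `Re ∫ = ∫ Re` form), XII-t `HandoffEvenRescueCubic`, XII-q `HandoffMirrorPolarization`.
-/

set_option linter.dupNamespace false  -- the mandated namespace repeats `RiemannHypothesis`

noncomputable section

open Set Complex MeasureTheory Literature.NumberTheory.LFunctions
open Summit.RiemannHypothesis.RiemannHypothesis.Theorems.Handoff (contribution)
open Summit.RiemannHypothesis.RiemannHypothesis.Theorems.HandoffDecomposition (contribution_eq_two_mul)
open scoped ComplexConjugate

namespace Summit.RiemannHypothesis.RiemannHypothesis.Theorems.HandoffEntranceExpansion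

variable {g : ℝ → ℂ} {b : ℝ}

/-! ## §1 Moments of the layer about the entrance point -/

/-- The layer `[L − b, b]` is symmetric about `L/2`: its first moment vanishes. [folklore] -/
theorem integral_layer_sub_center {L : ℝ} (hb : L / 2 ≤ b) : ∫ u in Icc (L - b) b, (u - L / 2) = 0 := by
  have hab : L - b ≤ b := by linarith
  rw [integral_Icc_eq_integral_Ioc, ← intervalIntegral.integral_of_le hab,
    intervalIntegral.integral_comp_sub_right (fun x : ℝ ↦ x) (L / 2), integral_id]
  ring

/-- The second moment of the layer about `L/2` is `2δ³/3`, `δ = b − L/2`. [folklore] -/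
theorem integral_layer_sub_center_sq {L : ℝ} (hb : L / 2 ≤ b) :
    ∫ u in Icc (L - b) b, (u - L / 2) ^ 2 = 2 * (b - L / 2) ^ 3 / 3 := by
  have hab : L - b ≤ b := by linarith
  rw [integral_Icc_eq_integral_Ioc, ← intervalIntegral.integral_of_le hab,
    intervalIntegral.integral_comp_sub_right (fun x : ℝ ↦ x ^ 2) (L / 2), integral_pow]
  ring

/-- The model (quadratic) integrand integrates to the VALUE term plus the SLOPE term: the mixed first-order term drops out.
`∫_{layer} (A + B·(u − m) + C·(u − m)²) du = 2δ·A + (2δ³/3)·C`. [folklore] -/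
theorem integral_layer_model {L : ℝ} (hb : L / 2 ≤ b) (A B C : ℂ) :
    ∫ u in Icc (L - b) b, (A + B * ((u - L / 2 : ℝ) : ℂ) + C * ((u - L / 2 : ℝ) : ℂ) ^ 2)
      = ((2 * (b - L / 2) : ℝ) : ℂ) * A + ((2 * (b - L / 2) ^ 3 / 3 : ℝ) : ℂ) * C := by
  have hab : L - b ≤ b := by linarith
  have hfin : volume (Icc (L - b) b) < ⊤ := measure_Icc_lt_top
  have hvol : volume.real (Icc (L - b) b) = 2 * (b - L / 2) := by rw [Real.volume_real_Icc_of_le hab]; ring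
  have i0 : IntegrableOn (fun _ : ℝ ↦ A) (Icc (L - b) b) := integrableOn_const (by simp)
  have hc1 : Continuous fun u : ℝ ↦ ((u - L / 2 : ℝ) : ℂ) := by fun_prop
  have i1 : IntegrableOn (fun u : ℝ ↦ B * ((u - L / 2 : ℝ) : ℂ)) (Icc (L - b) b) :=
    ((hc1.const_mul B).continuousOn).integrableOn_compact isCompact_Icc
  have i2 : IntegrableOn (fun u : ℝ ↦ C * ((u - L / 2 : ℝ) : ℂ) ^ 2) (Icc (L - b) b) :=
    (((hc1.pow 2).const_mul C).continuousOn).integrableOn_compact isCompact_Icc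
  have i01 : IntegrableOn (fun u : ℝ ↦ A + B * ((u - L / 2 : ℝ) : ℂ)) (Icc (L - b) b) := i0.add i1
  rw [integral_add i01 i2, integral_add i0 i1, setIntegral_const, hvol, integral_const_mul, integral_const_mul]
  have e1 : ∫ u in Icc (L - b) b, ((u - L / 2 : ℝ) : ℂ) = 0 := by
    rw [integral_complex_ofReal, integral_layer_sub_center hb]; simp
  have e2 : ∫ u in Icc (L - b) b, ((u - L / 2 : ℝ) : ℂ) ^ 2 = ((2 * (b - L / 2) ^ 3 / 3 : ℝ) : ℂ) := by
    have : (fun u : ℝ ↦ ((u - L / 2 : ℝ) : ℂ) ^ 2) = fun u : ℝ ↦ (((u - L / 2) ^ 2 : ℝ) : ℂ) := by funext u; push_cast; ring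
    rw [this, integral_complex_ofReal, integral_layer_sub_center_sq hb]
  rw [e1, e2, Complex.real_smul]
  ring

/-! ## §2 The two-term expansion of the layer integral about the entrance point -/

/-- **SECOND-ORDER ENTRANCE-POINT EXPANSION.** Let `L = log q`, `m = L/2`, `δ = b − m ≥ 0`. Suppose on the layer `[L − b, b] = [m − δ, m + δ]`
the function has a first-order Taylor modulus about `m`, `‖g(u) − g₀ − g₁(u − m)‖ ≤ (M₂/2)(u − m)²` (`g₀ = g(m)`, `g₁` = «`g′(m)`»), and on the
mirror layer `[−b, b − L] = [−m − δ, −m + δ]` about `−m`, `‖g(v) − h₀ − h₁(v + m)‖ ≤ (M₂/2)(v + m)²`. Then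
`‖∫_{layer} g(u)·conj g(u − L) du − (2δ·g₀·conj h₀ + (2δ³/3)·g₁·conj h₁)‖ ≤ M₂δ³·(‖g₀‖ + ‖h₀‖ + (‖g₁‖ + ‖h₁‖)δ + M₂δ²/2)` —
the VALUE term (order δ) and the SLOPE term (order δ³); the mixed order-δ² term integrates to zero by the symmetry of the layer about `m`.
(Requires only integrability of the cross term on the layer: the kinked class. The constant is not optimised: with the exact second
moment the right side improves by a factor 3.) [folklore] -/
theorem norm_layerIntegral_sub_twoTerm_le {q : ℕ} {M₂ : ℝ} {g₀ g₁ h₀ h₁ : ℂ}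
    (hgi : IntegrableOn (fun u ↦ g u * conj (g (u - Real.log q))) (Icc (Real.log q - b) b)) (hM0 : 0 ≤ M₂)
    (hb : Real.log q / 2 ≤ b)
    (hT : ∀ u ∈ Icc (Real.log q - b) b, ‖g u - g₀ - g₁ * ((u - Real.log q / 2 : ℝ) : ℂ)‖ ≤ M₂ / 2 * (u - Real.log q / 2) ^ 2)
    (hT' : ∀ v ∈ Icc (-b) (b - Real.log q), ‖g v - h₀ - h₁ * ((v + Real.log q / 2 : ℝ) : ℂ)‖ ≤ M₂ / 2 * (v + Real.log q / 2) ^ 2) :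
    ‖(∫ u in Icc (Real.log q - b) b, g u * conj (g (u - Real.log q)))
        - (((2 * (b - Real.log q / 2) : ℝ) : ℂ) * (g₀ * conj h₀) + ((2 * (b - Real.log q / 2) ^ 3 / 3 : ℝ) : ℂ) * (g₁ * conj h₁))‖
      ≤ M₂ * (b - Real.log q / 2) ^ 3 *
          (‖g₀‖ + ‖h₀‖ + (‖g₁‖ + ‖h₁‖) * (b - Real.log q / 2) + M₂ * (b - Real.log q / 2) ^ 2 / 2) := by
  set L := Real.log q with hL
  set m := Real.log q / 2 with hm
  set δ := b - m with hδ
  set S : Set ℝ := Icc (L - b) b with hS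
  have hδ0 : 0 ≤ δ := by rw [hδ]; linarith
  have hLb : L - b ≤ b := by rw [hL]; linarith
  have hvol : volume.real S = 2 * δ := by rw [hS, Real.volume_real_Icc_of_le hLb, hδ, hm]; ring
  have hSfin : volume S < ⊤ := by rw [hS]; exact measure_Icc_lt_top
  -- the model integrand and its integral
  set p : ℝ → ℂ := fun u ↦ (g₀ + g₁ * ((u - m : ℝ) : ℂ)) * conj (h₀ + h₁ * ((u - m : ℝ) : ℂ)) with hp
  have hp_expand : ∀ u, p u = g₀ * conj h₀ + (g₁ * conj h₀ + g₀ * conj h₁) * ((u - m : ℝ) : ℂ)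
      + g₁ * conj h₁ * ((u - m : ℝ) : ℂ) ^ 2 := by
    intro u; rw [hp]; simp only [map_add, map_mul, Complex.conj_ofReal]; ring
  have hmL : m = L / 2 := by rw [hm, hL]
  have hIp : ∫ u in S, p u = ((2 * δ : ℝ) : ℂ) * (g₀ * conj h₀) + ((2 * δ ^ 3 / 3 : ℝ) : ℂ) * (g₁ * conj h₁) := by
    simp_rw [hp_expand]
    rw [hS, hmL, integral_layer_model (by rw [hL]; exact hb), hδ, hmL]
  have hpc : Continuous p := by rw [hp]; fun_prop
  have hpi : IntegrableOn p S volume := hpc.continuousOn.integrableOn_compact (by rw [hS]; exact isCompact_Icc)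
  -- pointwise bound for the difference
  have hpt : ∀ u ∈ S, ‖g u * conj (g (u - L)) - p u‖
      ≤ M₂ / 2 * δ ^ 2 * (‖g₀‖ + ‖h₀‖ + (‖g₁‖ + ‖h₁‖) * δ + M₂ * δ ^ 2 / 2) := by
    intro u hu
    rw [hS, mem_Icc] at hu
    have ht : |u - m| ≤ δ := by rw [abs_le]; constructor <;> [linarith [hu.1]; linarith [hu.2]]
    have ht2 : (u - m) ^ 2 ≤ δ ^ 2 := by nlinarith [abs_nonneg (u - m), sq_abs (u - m)]
    have hv : u - L ∈ Icc (-b) (b - L) := ⟨by linarith [hu.1], by linarith [hu.2]⟩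
    have hvm : u - L + Real.log q / 2 = u - m := by rw [hm, hL]; ring
    have e1 : ‖g u - g₀ - g₁ * ((u - m : ℝ) : ℂ)‖ ≤ M₂ / 2 * δ ^ 2 :=
      (hT u (by rw [hS]; exact ⟨hu.1, hu.2⟩)).trans (mul_le_mul_of_nonneg_left ht2 (by linarith))
    have e2 : ‖g (u - L) - h₀ - h₁ * ((u - m : ℝ) : ℂ)‖ ≤ M₂ / 2 * δ ^ 2 := by
      have h := hT' (u - L) hv
      rw [hvm] at h
      exact h.trans (mul_le_mul_of_nonneg_left ht2 (by linarith))
    have n1 : ‖g₀ + g₁ * ((u - m : ℝ) : ℂ)‖ ≤ ‖g₀‖ + ‖g₁‖ * δ := by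
      calc ‖g₀ + g₁ * ((u - m : ℝ) : ℂ)‖ ≤ ‖g₀‖ + ‖g₁ * ((u - m : ℝ) : ℂ)‖ := norm_add_le _ _
        _ = ‖g₀‖ + ‖g₁‖ * |u - m| := by rw [norm_mul, Complex.norm_real, Real.norm_eq_abs]
        _ ≤ ‖g₀‖ + ‖g₁‖ * δ := by gcongr
    have n2 : ‖g (u - L)‖ ≤ ‖h₀‖ + ‖h₁‖ * δ + M₂ / 2 * δ ^ 2 := by
      calc ‖g (u - L)‖ = ‖(h₀ + h₁ * ((u - m : ℝ) : ℂ)) + (g (u - L) - h₀ - h₁ * ((u - m : ℝ) : ℂ))‖ := by ring_nf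
        _ ≤ ‖h₀ + h₁ * ((u - m : ℝ) : ℂ)‖ + ‖g (u - L) - h₀ - h₁ * ((u - m : ℝ) : ℂ)‖ := norm_add_le _ _
        _ ≤ (‖h₀‖ + ‖h₁‖ * δ) + M₂ / 2 * δ ^ 2 := by
            gcongr
            calc ‖h₀ + h₁ * ((u - m : ℝ) : ℂ)‖ ≤ ‖h₀‖ + ‖h₁ * ((u - m : ℝ) : ℂ)‖ := norm_add_le _ _
              _ = ‖h₀‖ + ‖h₁‖ * |u - m| := by rw [norm_mul, Complex.norm_real, Real.norm_eq_abs]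
              _ ≤ ‖h₀‖ + ‖h₁‖ * δ := by gcongr
    -- g u * conj(g(u-L)) - p u = (g u - (g₀ + g₁ t)) * conj(g(u-L)) + (g₀ + g₁ t) * conj(g(u-L) - (h₀ + h₁ t))
    have hsplit : g u * conj (g (u - L)) - p u
        = (g u - g₀ - g₁ * ((u - m : ℝ) : ℂ)) * conj (g (u - L))
          + (g₀ + g₁ * ((u - m : ℝ) : ℂ)) * conj (g (u - L) - h₀ - h₁ * ((u - m : ℝ) : ℂ)) := by
      rw [hp]; simp only [map_sub, map_add, map_mul, Complex.conj_ofReal]; ring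
    rw [hsplit]
    calc ‖(g u - g₀ - g₁ * ((u - m : ℝ) : ℂ)) * conj (g (u - L))
          + (g₀ + g₁ * ((u - m : ℝ) : ℂ)) * conj (g (u - L) - h₀ - h₁ * ((u - m : ℝ) : ℂ))‖
        ≤ ‖g u - g₀ - g₁ * ((u - m : ℝ) : ℂ)‖ * ‖g (u - L)‖
          + ‖g₀ + g₁ * ((u - m : ℝ) : ℂ)‖ * ‖g (u - L) - h₀ - h₁ * ((u - m : ℝ) : ℂ)‖ := by
          refine (norm_add_le _ _).trans (le_of_eq ?_)
          rw [norm_mul, norm_mul, Complex.norm_conj, Complex.norm_conj]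
      _ ≤ M₂ / 2 * δ ^ 2 * (‖h₀‖ + ‖h₁‖ * δ + M₂ / 2 * δ ^ 2) + (‖g₀‖ + ‖g₁‖ * δ) * (M₂ / 2 * δ ^ 2) := by
          gcongr
      _ = M₂ / 2 * δ ^ 2 * (‖g₀‖ + ‖h₀‖ + (‖g₁‖ + ‖h₁‖) * δ + M₂ * δ ^ 2 / 2) := by ring
  -- assemble
  have hdiff : (∫ u in S, g u * conj (g (u - L))) - ∫ u in S, p u = ∫ u in S, (g u * conj (g (u - L)) - p u) :=
    (integral_sub hgi hpi).symm
  rw [← hIp, hdiff]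
  have hmain := norm_setIntegral_le_of_norm_le_const hSfin hpt
  rw [hvol] at hmain
  refine hmain.trans (le_of_eq ?_)
  ring

/-! ## §3 The two-term law for the contribution, by parity -/

/-- The contribution of `q` as the integral of the REAL PART of the cross term over the layer (prove-2's `contribution_eq_two_mul`, the
convolution unfolded, the integrand restricted to the layer where it lives, and `Re ∫ = ∫ Re`). [folklore] -/
theorem contribution_eq_neg_mul_integral_re_layer (hsupp : tsupport g ⊆ Icc (-b) b) {q : ℕ}
    (hgi : IntegrableOn (fun u ↦ g u * conj (g (u - Real.log q))) (Icc (Real.log q - b) b)) :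
    contribution q g = -(2 * Real.log q / Real.sqrt q *
      ∫ u in Icc (Real.log q - b) b, (g u * conj (g (u - Real.log q))).re) := by
  rw [contribution_eq_two_mul, weilConv_apply]
  have e : (fun u ↦ g u * weilReflect g (Real.log q - u)) = fun u ↦ g u * conj (g (u - Real.log q)) := by
    funext u
    simp [weilReflect, neg_sub]
  have hzero : ∀ u ∉ Icc (Real.log q - b) b, g u * conj (g (u - Real.log q)) = 0 := by
    intro u hu
    by_contra h
    have h1 : g u ≠ 0 := fun h0 ↦ h (by rw [h0, zero_mul])
    have h2 : g (u - Real.log q) ≠ 0 := fun h0 ↦ h (by rw [h0, map_zero, mul_zero])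
    have hu1 := hsupp (subset_tsupport g (Function.mem_support.mpr h1))
    have hu2 := hsupp (subset_tsupport g (Function.mem_support.mpr h2))
    exact hu ⟨by linarith [hu2.1], hu1.2⟩
  rw [e, ← setIntegral_eq_integral_of_forall_compl_eq_zero (s := Icc (Real.log q - b) b) hzero]
  congr 2
  exact (integral_re hgi).symm

/-- **EVEN TWO-TERM LAW** (`g(−t) = g(t)`; kinked class): if `‖g(u) − g₀ − g₁(u − m)‖ ≤ (M₂/2)(u − m)²` on the layer (`m = (log q)/2`), then
`|contribution_q(g) + (2 log q/√q)·(2δ‖g₀‖² − (2δ³/3)‖g₁‖²)| ≤ (2 log q/√q)·M₂δ³·(2‖g₀‖ + 2‖g₁‖δ + M₂δ²/2)`: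
the even function is CHARGED its squared VALUE at the entrance point (order δ) and REWARDED its squared SLOPE there (order δ³) — at an even
wall the bottom puts a node near `m` (EDGESIGN: at `m + δ/4`), killing the charge and living on the reward. [folklore] -/
theorem abs_contribution_add_twoTerm_le_of_even (hsupp : tsupport g ⊆ Icc (-b) b) (hev : ∀ t, g (-t) = g t) {q : ℕ} {M₂ : ℝ}
    {g₀ g₁ : ℂ} (hgi : IntegrableOn (fun u ↦ g u * conj (g (u - Real.log q))) (Icc (Real.log q - b) b)) (hM0 : 0 ≤ M₂)
    (hb : Real.log q / 2 ≤ b)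
    (hT : ∀ u ∈ Icc (Real.log q - b) b, ‖g u - g₀ - g₁ * ((u - Real.log q / 2 : ℝ) : ℂ)‖ ≤ M₂ / 2 * (u - Real.log q / 2) ^ 2) :
    |contribution q g + 2 * Real.log q / Real.sqrt q *
        (2 * (b - Real.log q / 2) * ‖g₀‖ ^ 2 - 2 * (b - Real.log q / 2) ^ 3 / 3 * ‖g₁‖ ^ 2)|
      ≤ 2 * Real.log q / Real.sqrt q * (M₂ * (b - Real.log q / 2) ^ 3 *
          (2 * ‖g₀‖ + 2 * ‖g₁‖ * (b - Real.log q / 2) + M₂ * (b - Real.log q / 2) ^ 2 / 2)) := by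
  have hcq : 0 ≤ 2 * Real.log q / Real.sqrt q :=
    div_nonneg (mul_nonneg zero_le_two (Real.log_natCast_nonneg q)) (Real.sqrt_nonneg _)
  -- the mirror-layer Taylor data from evenness: h₀ = g₀, h₁ = −g₁
  have hT' : ∀ v ∈ Icc (-b) (b - Real.log q), ‖g v - g₀ - (-g₁) * ((v + Real.log q / 2 : ℝ) : ℂ)‖ ≤ M₂ / 2 * (v + Real.log q / 2) ^ 2 := by
    intro v hv
    have hv' : -v ∈ Icc (Real.log q - b) b := ⟨by linarith [hv.2], by linarith [hv.1]⟩
    have h := hT (-v) hv'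
    rw [hev v] at h
    have e1 : ((-v - Real.log q / 2 : ℝ) : ℂ) = -((v + Real.log q / 2 : ℝ) : ℂ) := by push_cast; ring
    rw [e1] at h
    have e2 : (-v - Real.log q / 2) ^ 2 = (v + Real.log q / 2) ^ 2 := by ring
    rw [e2] at h
    convert h using 2
    ring
  have h2 := norm_layerIntegral_sub_twoTerm_le hgi hM0 hb hT hT'
  have hIre : ∫ u in Icc (Real.log q - b) b, (g u * conj (g (u - Real.log q))).re
      = (∫ u in Icc (Real.log q - b) b, g u * conj (g (u - Real.log q))).re := integral_re hgi
  rw [contribution_eq_neg_mul_integral_re_layer hsupp hgi, hIre]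
  set I := ∫ u in Icc (Real.log q - b) b, g u * conj (g (u - Real.log q)) with hI
  set cq := 2 * Real.log q / Real.sqrt q
  set δ := b - Real.log q / 2 with hδ
  have hmain : (((2 * δ : ℝ) : ℂ) * (g₀ * conj g₀) + ((2 * δ ^ 3 / 3 : ℝ) : ℂ) * (g₁ * conj (-g₁))).re
      = 2 * δ * ‖g₀‖ ^ 2 - 2 * δ ^ 3 / 3 * ‖g₁‖ ^ 2 := by
    rw [map_neg, mul_neg, Complex.mul_conj, Complex.mul_conj, Complex.add_re, Complex.re_ofReal_mul, mul_neg, Complex.neg_re,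
      Complex.re_ofReal_mul, Complex.ofReal_re, Complex.ofReal_re, Complex.normSq_eq_norm_sq, Complex.normSq_eq_norm_sq]
    ring
  have hre : |I.re - (2 * δ * ‖g₀‖ ^ 2 - 2 * δ ^ 3 / 3 * ‖g₁‖ ^ 2)| ≤
      M₂ * δ ^ 3 * (‖g₀‖ + ‖g₀‖ + (‖g₁‖ + ‖-g₁‖) * δ + M₂ * δ ^ 2 / 2) := by
    rw [← hmain, ← Complex.sub_re]
    exact (Complex.abs_re_le_norm _).trans h2
  rw [norm_neg] at hre
  have e : -(cq * I.re) + cq * (2 * δ * ‖g₀‖ ^ 2 - 2 * δ ^ 3 / 3 * ‖g₁‖ ^ 2)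
      = -(cq * (I.re - (2 * δ * ‖g₀‖ ^ 2 - 2 * δ ^ 3 / 3 * ‖g₁‖ ^ 2))) := by ring
  rw [e, abs_neg, abs_mul, abs_of_nonneg hcq]
  refine (mul_le_mul_of_nonneg_left hre hcq).trans (le_of_eq ?_)
  ring

/-- **ODD TWO-TERM LAW** (`g(−t) = −g(t)`; kinked class): with the same Taylor modulus at `m = (log q)/2`,
`|contribution_q(g) − (2 log q/√q)·(2δ‖g₀‖² − (2δ³/3)‖g₁‖²)| ≤ (2 log q/√q)·M₂δ³·(2‖g₀‖ + 2‖g₁‖δ + M₂δ²/2)`: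
the odd function is REWARDED its squared value at the entrance point (order δ — the wall-carrying term, XII-ε) and charged its squared
slope (order δ³). One expansion about the entrance point, opposite signs by parity, term by term. [folklore] -/
theorem abs_contribution_sub_twoTerm_le_of_odd (hsupp : tsupport g ⊆ Icc (-b) b) (hodd : ∀ t, g (-t) = -g t) {q : ℕ} {M₂ : ℝ}
    {g₀ g₁ : ℂ} (hgi : IntegrableOn (fun u ↦ g u * conj (g (u - Real.log q))) (Icc (Real.log q - b) b)) (hM0 : 0 ≤ M₂)
    (hb : Real.log q / 2 ≤ b)
    (hT : ∀ u ∈ Icc (Real.log q - b) b, ‖g u - g₀ - g₁ * ((u - Real.log q / 2 : ℝ) : ℂ)‖ ≤ M₂ / 2 * (u - Real.log q / 2) ^ 2) :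
    |contribution q g - 2 * Real.log q / Real.sqrt q *
        (2 * (b - Real.log q / 2) * ‖g₀‖ ^ 2 - 2 * (b - Real.log q / 2) ^ 3 / 3 * ‖g₁‖ ^ 2)|
      ≤ 2 * Real.log q / Real.sqrt q * (M₂ * (b - Real.log q / 2) ^ 3 *
          (2 * ‖g₀‖ + 2 * ‖g₁‖ * (b - Real.log q / 2) + M₂ * (b - Real.log q / 2) ^ 2 / 2)) := by
  have hcq : 0 ≤ 2 * Real.log q / Real.sqrt q :=
    div_nonneg (mul_nonneg zero_le_two (Real.log_natCast_nonneg q)) (Real.sqrt_nonneg _)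
  -- the mirror-layer Taylor data from oddness: h₀ = −g₀, h₁ = g₁
  have hT' : ∀ v ∈ Icc (-b) (b - Real.log q), ‖g v - (-g₀) - g₁ * ((v + Real.log q / 2 : ℝ) : ℂ)‖ ≤ M₂ / 2 * (v + Real.log q / 2) ^ 2 := by
    intro v hv
    have hv' : -v ∈ Icc (Real.log q - b) b := ⟨by linarith [hv.2], by linarith [hv.1]⟩
    have h := hT (-v) hv'
    rw [hodd v] at h
    have e1 : ((-v - Real.log q / 2 : ℝ) : ℂ) = -((v + Real.log q / 2 : ℝ) : ℂ) := by push_cast; ring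
    rw [e1, show -g v - g₀ - g₁ * -((v + Real.log q / 2 : ℝ) : ℂ) = -(g v - -g₀ - g₁ * ((v + Real.log q / 2 : ℝ) : ℂ)) from by ring,
      norm_neg] at h
    have e2 : (-v - Real.log q / 2) ^ 2 = (v + Real.log q / 2) ^ 2 := by ring
    rwa [e2] at h
  have h2 := norm_layerIntegral_sub_twoTerm_le hgi hM0 hb hT hT'
  have hIre : ∫ u in Icc (Real.log q - b) b, (g u * conj (g (u - Real.log q))).re
      = (∫ u in Icc (Real.log q - b) b, g u * conj (g (u - Real.log q))).re := integral_re hgi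
  rw [contribution_eq_neg_mul_integral_re_layer hsupp hgi, hIre]
  set I := ∫ u in Icc (Real.log q - b) b, g u * conj (g (u - Real.log q)) with hI
  set cq := 2 * Real.log q / Real.sqrt q
  set δ := b - Real.log q / 2 with hδ
  have hmain : (((2 * δ : ℝ) : ℂ) * (g₀ * conj (-g₀)) + ((2 * δ ^ 3 / 3 : ℝ) : ℂ) * (g₁ * conj g₁)).re
      = -(2 * δ * ‖g₀‖ ^ 2 - 2 * δ ^ 3 / 3 * ‖g₁‖ ^ 2) := by
    rw [map_neg, mul_neg, Complex.mul_conj, Complex.mul_conj, Complex.add_re, mul_neg, Complex.neg_re, Complex.re_ofReal_mul,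
      Complex.re_ofReal_mul, Complex.ofReal_re, Complex.ofReal_re, Complex.normSq_eq_norm_sq, Complex.normSq_eq_norm_sq]
    ring
  have hre : |I.re - -(2 * δ * ‖g₀‖ ^ 2 - 2 * δ ^ 3 / 3 * ‖g₁‖ ^ 2)| ≤
      M₂ * δ ^ 3 * (‖g₀‖ + ‖-g₀‖ + (‖g₁‖ + ‖g₁‖) * δ + M₂ * δ ^ 2 / 2) := by
    rw [← hmain, ← Complex.sub_re]
    exact (Complex.abs_re_le_norm _).trans h2
  rw [norm_neg] at hre
  have e : -(cq * I.re) - cq * (2 * δ * ‖g₀‖ ^ 2 - 2 * δ ^ 3 / 3 * ‖g₁‖ ^ 2)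
      = -(cq * (I.re - -(2 * δ * ‖g₀‖ ^ 2 - 2 * δ ^ 3 / 3 * ‖g₁‖ ^ 2))) := by ring
  rw [e, abs_neg, abs_mul, abs_of_nonneg hcq]
  refine (mul_le_mul_of_nonneg_left hre hcq).trans (le_of_eq ?_)
  ring

end Summit.RiemannHypothesis.RiemannHypothesis.Theorems.HandoffEntranceExpansion
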